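import Summits.BirchSwinnertonDyer.BirchSwinnertonDyer.Theorems.GenusKolyvaginAtTwoGenusPrimitiveSupplyAtTwoGenusPairSelmerOfDuality
import Summits.BirchSwinnertonDyer.BirchSwinnertonDyer.Theorems.GenusKolyvaginAtTwoMultiGenusPrimitivityAtTwoOddTwistNotTwoDvd
import HarnessLib

/-!
# Route `GenusKolyvaginAtTwo` (cruxes #2 `GenusPrimitiveSupplyAtTwo`, stmt-BirchSwinnertonDyer-22136, and U =
# `MultiGenusPrimitivityAtTwo`, stmt-BirchSwinnertonDyer-24947): the lead's WALL-ROW-1 certificate chain WITHOUT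
# `cor34i_singleton_rat` — modulo Poitou–Tate duality and Tate's local Euler characteristic

Width seat `bsd-line-gk2-p5` g8 (cell `bsd-f1-sign2`, SUPPLY lineage), twelfth file of the series (crux workfile
`Lines/genus-supply-mr-instantiation.md`). THEOREMS ONLY (no definition, no named fact, no `sorry`); helper; no item is closed;
BSD is not proved by any of this.

WHAT. The lead's row-1 composition (`GenusKoly.heegner_exists_multiGenusCertificate_rowOne_of_cor34i_of_auxPrimitive` p616774 →
`…_of_cor34i_of_oddTwistPrimitive` p618536 → `…_of_cor34i_of_oddTwistNotTwoDvd`) takes the PRINT named fact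
`h34 : MazurRubin2010.cor34i_singleton_rat` and uses it once, through gk2-p4's capstone
`GenusKolyTwistingPrime.exists_kolyvaginPrime_genusPair_selmer_of_cor34i` (DOWN direction only). With this seat's h34-free capstone
(`GenusKolyTwistLocal.exists_kolyvaginPrime_pow_one_genusPair_selmer_of_duality`, p625008, from the kernel DOWN theorem p624297) the
whole chain is re-derived here with `h34` REPLACED by the displayed print facts `hPT : poitouTate_selmerStructure_duality_real ℚ`
(Milne I.4.10) and `hEP : ∀ v, localEulerPoincareCharacteristic ℚ_v` (Milne I.2.8):
`exists_kolyvaginPrime_genusPair_selmer_of_duality` (gk2-p4's original depth-one statement p615571, h34-free) and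
`heegner_exists_multiGenusCertificate_rowOne_of_duality_of_auxPrimitive / _of_oddTwistPrimitive / _of_oddTwistNotTwoDvd`
(the lead's statements and proofs VERBATIM but for `h34 ↦ hPT, hEP`). The open kernel (`haux` / `hprim`: the odd-twist
`2`-primitivity, W. Zhang's base case at `2`) is untouched and displayed exactly as before.

References: [MazurRubin2010] Prop. 3.3, Cor. 3.4 (i); [MilneADT2006] I Thm. 2.8, I Thm. 4.10; [GrossLMS1991] §§3–5;
[McCallumLMS1991] §5; [WZhang2014] Thm. 1.1.
-/

set_option linter.dupNamespace false -- tree convention: `Summit.BirchSwinnertonDyer.BirchSwinnertonDyer.Theorems` (summit = sub-problem)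
set_option autoImplicit false

noncomputable section

open scoped Classical

namespace Summit.BirchSwinnertonDyer.BirchSwinnertonDyer.Theorems.GenusKoly

open Finset NumberField WeierstrassCurve Literature.NumberTheory.EllipticCurves
  Literature.NumberTheory.EllipticCurves.ModularForms
  Literature.NumberTheory.GaloisRepresentations Literature.NumberTheory.GaloisCohomology Literature.NumberTheory
  Summit.BirchSwinnertonDyer.Rank1Residual.AdditivePotMult
  Summit.BirchSwinnertonDyer.Rank1Residual.X11b.RingClassConj
  Summit.BirchSwinnertonDyer.BirchSwinnertonDyer.Theorems.GenusKolyTwistingPrime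
  Summit.BirchSwinnertonDyer.BirchSwinnertonDyer.Theorems.GenusKolyTwistLocal

/-! ## §28 gk2-p4's depth-one capstone (p615571) without `cor34i_singleton_rat` -/

section Capstone

variable (W : WeierstrassCurve ℚ) [W.IsElliptic] [W.IsGloballyMinimal] {K : Type} [Field K] [NumberField K]

/-- **The genus pair at a Kolyvagin twisting prime is `2`-Selmer-minimal — modulo {PT, Tate χ}, NO `cor34i_singleton_rat`**
(gk2-p4's `exists_kolyvaginPrime_genusPair_selmer_of_cor34i`, p615571, in its original depth-one currency): `W/ℚ` globally minimal,
`Δ_W < 0`, `ρ̄_{W,2}` onto, `#Sel₂(W) = 4`, `K` imaginary quadratic, `Wd` a globally minimal model of `W^{(d_K)}` with `#Sel₂(Wd) = 2`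
⟹ beyond every finite `B₀` a prime `ℓ ≡ 7 (mod 8)`, Kolyvagin for `(E, K, 2)`, with every elliptic model of `W^{(−ℓ)}` having
`#Sel₂ = 2` and every elliptic model of `Wd^{(−ℓ)}` having `#Sel₂ = 1` (drop the depth bookkeeping of
`exists_kolyvaginPrime_pow_one_genusPair_selmer_of_duality`). BSD is not proved by this.
[cite: MazurRubin2010, Prop. 3.3, Cor. 3.4 (i), Lemma 3.5] [cite: MilneADT2006, I Thm. 2.8, I Thm. 4.10] [cite: GrossLMS1991, §3 (3.1)–(3.3)] -/
theorem exists_kolyvaginPrime_genusPair_selmer_of_duality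
    (hPT : poitouTate_selmerStructure_duality_real ℚ)
    (hEP : ∀ v : IsDedekindDomain.HeightOneSpectrum (𝓞 ℚ), localEulerPoincareCharacteristic (v.adicCompletion ℚ))
    (hsurj : W.HasSurjectiveModNGaloisRep 2) (hΔ : W.Δ < 0) (h4 : Nat.card (W.selmerGroup 2) = 4)
    (hK : IsImaginaryQuadratic K) {Wd : WeierstrassCurve ℚ} [Wd.IsElliptic] [Wd.IsGloballyMinimal]
    {C : VariableChange ℚ} (hWd : C • W.quadraticTwist (discr K : ℚ) = Wd)
    (h2 : Nat.card (Wd.selmerGroup 2) = 2) (B₀ : Finset ℕ) :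
    ∃ ℓ : ℕ, ∃ _ : Fact ℓ.Prime, ℓ ∉ B₀ ∧ ℓ % 8 = 7 ∧ IsKolyvaginPrime (W.conductorNorm ℤ) W K 2 ℓ ∧
      (∀ (W₁ : WeierstrassCurve ℚ) [W₁.IsElliptic],
        (∃ C₁ : VariableChange ℚ, C₁ • W.quadraticTwist (-(ℓ : ℚ)) = W₁) →
          Nat.card (W₁.selmerGroup 2) = 2) ∧
      (∀ (W₂ : WeierstrassCurve ℚ) [W₂.IsElliptic],
        (∃ C₂ : VariableChange ℚ, C₂ • Wd.quadraticTwist (-(ℓ : ℚ)) = W₂) →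
          Nat.card (W₂.selmerGroup 2) = 1) := by
  obtain ⟨ℓ, hℓF, hℓB₀, hℓ8, hKoly, -, -, -, hW₁, hW₂⟩ :=
    exists_kolyvaginPrime_pow_one_genusPair_selmer_of_duality W hPT hEP hsurj hΔ h4 hK hWd h2 B₀
  exact ⟨ℓ, hℓF, hℓB₀, hℓ8, hKoly, hW₁, hW₂⟩

end Capstone

/-! ## §29 The lead's WALL-ROW-1 certificate chain without `cor34i_singleton_rat` -/

section Heegner

variable {W : WeierstrassCurve ℚ} [NeZero (W.conductorNorm ℤ)] {K : Type} [Field K] [NumberField K]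
  {Dt : ModularParametrizationData W (W.conductorNorm ℤ)} {β : ℤ} {ι : K →+* ℂ}

/-- **WALL ROW 1: the crux's certificate from Cor. 3.4 (i) and AUXILIARY-FIELD PRIMITIVITY.** `W` globally minimal with `Δ < 0`,
`ρ̄_{W,2}` onto, `#Sel₂(W) = 4`; `K` imaginary quadratic, odd `d_K ≠ −3`, Heegner; `Wd = C • W^{(d_K)}` globally minimal with
`#Sel₂(Wd) = 2`; a conductor-1 datum `d₁` with `2 ∣ P(1)` (`M₀ ≥ 1`). IF (`haux`) at every Kolyvagin prime `ℓ ≡ 7 (8)` at `2` whose even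
genus twist `Wd^{(−ℓ)}` has all elliptic models Sel₂-trivial, for all data/radicals/enumerations/reduced genus points `W_ℓ` at level
`ℓ`, no odd multiple of `W_ℓ` is twice a `ℚ(θ_ℓ)`-rational point — THEN the certificate clause of `MultiGenusPrimitivityAtTwo` /
`stub_positiveDepth` holds. CONDITIONAL on the displayed print facts `hPT` (Poitou–Tate duality for Selmer structures) and `hEP` (Tate's local Euler characteristic) — NOT on `cor34i_singleton_rat` — and on `haux` (the open kernel); the
Kolyvagin prime, the datum, the radicals, `G` and `W_ℓ` are PRODUCED (gk2-p4's capstone in the duality form `exists_kolyvaginPrime_genusPair_selmer_of_duality`; Gross §3 CM facts proved; depth law).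
[cite: MazurRubin2010, Cor. 3.4 (i), Prop. 3.3] [cite: GrossLMS1991, §3 (3.1)–(3.5), §4 (4.1), Lemma 4.3, §5]
[cite: McCallumLMS1991, §5] [cite: WZhang2014, Thm. 1.1 (the p ≥ 5 prototype)] -/
theorem heegner_exists_multiGenusCertificate_rowOne_of_duality_of_auxPrimitive [W.IsElliptic] [W.IsGloballyMinimal]
    (hPT : poitouTate_selmerStructure_duality_real ℚ)
    (hEP : ∀ v : IsDedekindDomain.HeightOneSpectrum (𝓞 ℚ), localEulerPoincareCharacteristic (v.adicCompletion ℚ))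
    (hK : IsImaginaryQuadratic K) (hodd : Odd (NumberField.discr K)) (h3 : NumberField.discr K ≠ -3)
    (hH : SatisfiesHeegnerHypothesis (W.conductorNorm ℤ) K) (hsurj : W.HasSurjectiveModNGaloisRep ((2 : ℤ) ^ 1))
    (hΔ : W.Δ < 0) (h4 : Nat.card (W.selmerGroup 2) = 4)
    {Wd : WeierstrassCurve ℚ} [Wd.IsElliptic] [Wd.IsGloballyMinimal] {C : VariableChange ℚ}
    (hWd : C • W.quadraticTwist (NumberField.discr K : ℚ) = Wd) (h2 : Nat.card (Wd.selmerGroup 2) = 2)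
    (d₁ : KolyvaginHeegnerData Dt β ι 1)
    (hM : ∃ Q₁ : (W.baseChange (ringClassField K ι 1)).toAffine.Point, (2 : ℤ) • Q₁ = d₁.derivedPoint)
    (haux : ∀ ℓ : ℕ, ℓ.Prime → ℓ % 8 = 7 → Zhang2014.IsKolyvaginPrime (W.conductorNorm ℤ) W K 2 ℓ →
      (∀ (W₂ : WeierstrassCurve ℚ) [W₂.IsElliptic],
        (∃ C₂ : VariableChange ℚ, C₂ • Wd.quadraticTwist (-(ℓ : ℚ)) = W₂) → Nat.card (W₂.selmerGroup 2) = 1) →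
      ∀ (d : KolyvaginHeegnerData Dt β ι ℓ) (θ : ℕ → ringClassField K ι ℓ),
        (∀ ℓ' ∈ ℓ.primeFactors, θ ℓ' ^ 2 = algebraMap ℚ (ringClassField K ι ℓ) ((-1 : ℚ) ^ (ℓ' / 2) * ℓ')) →
      ∀ (G : Finset (ringClassField K ι ℓ ≃ₐ[ℚ] ringClassField K ι ℓ)), (∀ g, g ∈ G ↔ g ∈ ringClassGal ι ℓ) →
      ∀ (Wn : (W.baseChange (ringClassField K ι ℓ)).toAffine.Point),
        ((2 : ℤ) ^ ℓ.primeFactors.card) • Wn =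
          ∑ g ∈ G, (∏ ℓ' ∈ ℓ.primeFactors, (if g (θ ℓ') = θ ℓ' then (1 : ℤ) else -1)) •
            pointGalHom W (ringClassField K ι ℓ) g d.y →
      ∀ m : ℕ, Odd m → ¬ ∃ Q : (W.baseChange (ringClassField K ι ℓ)).toAffine.Point,
        (∀ g : ringClassField K ι ℓ ≃ₐ[ℚ] ringClassField K ι ℓ, g (θ ℓ) = θ ℓ →
          pointGalHom W (ringClassField K ι ℓ) g Q = Q) ∧ (2 : ℤ) • Q = (m : ℤ) • Wn) :
    ∃ (n : ℕ) (d : KolyvaginHeegnerData Dt β ι n) (θ : ℕ → ringClassField K ι n)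
      (T : Finset (ringClassField K ι n ≃ₐ[ℚ] ringClassField K ι n)),
      Squarefree n ∧ (∀ ℓ ∈ n.primeFactors, Zhang2014.IsKolyvaginPrime (W.conductorNorm ℤ) W K 2 ℓ) ∧
      (∀ ℓ ∈ n.primeFactors, θ ℓ ^ 2 = algebraMap ℚ (ringClassField K ι n) ((-1 : ℚ) ^ (ℓ / 2) * ℓ)) ∧
      (∀ g, g ∈ T ↔ g ∈ ringClassGal ι n ∧ ∀ ℓ ∈ n.primeFactors, g (θ ℓ) = θ ℓ) ∧
      ¬ ∃ Q : (W.baseChange (ringClassField K ι n)).toAffine.Point, (2 : ℤ) • Q =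
        ∑ g ∈ T, pointGalHom W (ringClassField K ι n) g d.y := by
  have hsurj2 : W.HasSurjectiveModNGaloisRep 2 := by simpa using hsurj
  -- the Kolyvagin prime with Sel₂-minimal genus pair (gk2-p4's capstone, mod {PT, Tate χ})
  obtain ⟨ℓ, hℓF, -, hℓ8, hKolyG, -, hSel1⟩ :=
    exists_kolyvaginPrime_genusPair_selmer_of_duality W hPT hEP hsurj2 hΔ h4 hK hWd h2 ∅
  have hℓ : ℓ.Prime := hℓF.out
  have hKolyZ : Zhang2014.IsKolyvaginPrime (W.conductorNorm ℤ) W K 2 ℓ :=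
    Zhang2014.isKolyvaginPrime_of_isKolyvaginPrime W Dt.isNewformOf Nat.prime_two hKolyG
  have hKoly : ∀ ℓ' ∈ ℓ.primeFactors, Zhang2014.IsKolyvaginPrime (W.conductorNorm ℤ) W K 2 ℓ' := by
    intro ℓ' hℓ'
    rw [Nat.Prime.primeFactors hℓ, Finset.mem_singleton] at hℓ'
    rw [hℓ']
    exact hKolyZ
  have hsq : Squarefree ℓ := Irreducible.squarefree hℓ
  -- datum, radicals, enumeration, reduced genus point at level `ℓ` (all unconditional)
  have hinert : ∀ q ∈ ℓ.primeFactors, (Ideal.span {(q : 𝓞 K)}).IsPrime := fun q hq ↦ (hKoly q hq).2.2.2.2.1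
  obtain ⟨d⟩ : Nonempty (KolyvaginHeegnerData Dt β ι ℓ) :=
    nonempty_kolyvaginHeegnerData_of_grossCM
      (phi_heegnerPointOfConductor_mem_range_map_ringClassField_holds (W.conductorNorm ℤ) W K)
      exists_generator_ringClassGalOver_holds hK hH Dt β ι d₁.dvd_sq_sub hsq hinert
  obtain ⟨θ, hθ⟩ := heegner_exists_multiGenusRadicals hK hsq hKoly d
  obtain ⟨G, hG⟩ := heegner_exists_finset_ringClassGal (ι := ι) hK hℓ.ne_zero
  obtain ⟨⟨Wn, hWn, -⟩, -⟩ := heegner_existsUnique_reducedGenusPoint hK hodd h3 hH hsurj hsq hKoly d hθ G hG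
  obtain ⟨s₀, hs₀, hs₀2⟩ := heegner_exists_sqrt_discr hK
  -- the even genus twist `Wd^{(−ℓ)}` is an elliptic model of `W^{(ℓ*·d_K)}` with `#Sel₂ = 1`
  have hℓ0 : (-(ℓ : ℚ)) ≠ 0 := neg_ne_zero.mpr (by exact_mod_cast hℓ.ne_zero)
  haveI : (Wd.quadraticTwist (-(ℓ : ℚ))).IsElliptic := isElliptic_quadraticTwist Wd hℓ0
  have hSelWe : Nat.card ((Wd.quadraticTwist (-(ℓ : ℚ))).selmerGroup 2) = 1 := hSel1 _ ⟨1, one_smul _ _⟩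
  have h4ℓ : 4 ∣ ℓ + 1 := by omega
  obtain ⟨C', hC'⟩ := exists_smul_quadraticTwist_pStar_mul_eq_twin_quadraticTwist (W := W) h4ℓ hWd
  exact heegner_exists_multiGenusCertificate_of_auxFieldPrimitive_levelOne hK hodd h3 hH hsurj d₁ hM
    ⟨ℓ, d, θ, G, Wn, s₀, (NumberField.discr K : ℚ), Wd.quadraticTwist (-(ℓ : ℚ)), inferInstance, hℓ, hKoly, hθ, hG, hs₀, hs₀2,
      ⟨C', hC'⟩, hSelWe, hWn, haux ℓ hℓ hℓ8 hKolyZ hSel1 d θ hθ G hG Wn hWn⟩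


/-- **WALL ROW 1: the crux's certificate from Cor. 3.4 (i) and ODD-TWIST PRIMITIVITY.** `W` globally minimal with `Δ < 0`,
`ρ̄_{W,2}` onto, `#Sel₂(W) = 4`; a Heegner field `K` with odd `d_K ≠ −3`; a globally minimal twin `Wd = C • W^{(d_K)}` with
`#Sel₂(Wd) = 2`; a conductor-1 datum `d₁` with `2 ∣ P(1)` (`M₀ ≥ 1`). IF (`hprim`) at every Kolyvagin prime `ℓ ≡ 7 (8)` at `2`
whose even genus twist `Wd^{(−ℓ)}` has all elliptic models Sel₂-trivial, for all data / radicals / enumerations / reduced genus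
points `W_ℓ`, every rational point `z₀` of the ODD twist `W^{(ℓ*)}` whose transport `Φ(ι z₀)` is an odd multiple of `W_ℓ` has no
odd multiple in `2·W^{(ℓ*)}(ℚ)` — THEN the certificate clause of `MultiGenusPrimitivityAtTwo` / `stub_positiveDepth` holds.
CONDITIONAL on the displayed print facts `hPT`, `hEP` (Poitou–Tate duality, Tate's local Euler characteristic) — NOT on `cor34i_singleton_rat` — and on `hprim` (the open kernel, now a statement about one rational
point on one rank-one quadratic twist over `ℚ`); the Kolyvagin prime, datum, radicals, `G`, `W_ℓ` (and `z₀`, by p617773) are PRODUCED.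
[cite: MazurRubin2010, Cor. 3.4 (i), Prop. 3.3] [cite: GrossLMS1991, §3 (3.1)–(3.5), §4 (4.1), Lemma 4.3, §5]
[cite: McCallumLMS1991, §5] [cite: WZhang2014, Thm. 1.1 (the p ≥ 5 prototype)] -/
theorem heegner_exists_multiGenusCertificate_rowOne_of_duality_of_oddTwistPrimitive [W.IsElliptic] [W.IsGloballyMinimal]
    (hPT : poitouTate_selmerStructure_duality_real ℚ)
    (hEP : ∀ v : IsDedekindDomain.HeightOneSpectrum (𝓞 ℚ), localEulerPoincareCharacteristic (v.adicCompletion ℚ))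
    (hK : IsImaginaryQuadratic K) (hodd : Odd (NumberField.discr K)) (h3 : NumberField.discr K ≠ -3)
    (hH : SatisfiesHeegnerHypothesis (W.conductorNorm ℤ) K) (hsurj : W.HasSurjectiveModNGaloisRep ((2 : ℤ) ^ 1))
    (hΔ : W.Δ < 0) (h4 : Nat.card (W.selmerGroup 2) = 4)
    {Wd : WeierstrassCurve ℚ} [Wd.IsElliptic] [Wd.IsGloballyMinimal] {C : VariableChange ℚ}
    (hWd : C • W.quadraticTwist (NumberField.discr K : ℚ) = Wd) (h2 : Nat.card (Wd.selmerGroup 2) = 2)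
    (d₁ : KolyvaginHeegnerData Dt β ι 1)
    (hM : ∃ Q₁ : (W.baseChange (ringClassField K ι 1)).toAffine.Point, (2 : ℤ) • Q₁ = d₁.derivedPoint)
    (hprim : ∀ ℓ : ℕ, ℓ.Prime → ℓ % 8 = 7 → Zhang2014.IsKolyvaginPrime (W.conductorNorm ℤ) W K 2 ℓ →
      (∀ (W₂ : WeierstrassCurve ℚ) [W₂.IsElliptic],
        (∃ C₂ : VariableChange ℚ, C₂ • Wd.quadraticTwist (-(ℓ : ℚ)) = W₂) → Nat.card (W₂.selmerGroup 2) = 1) →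
      ∀ (d : KolyvaginHeegnerData Dt β ι ℓ) (θ : ℕ → ringClassField K ι ℓ),
        (∀ ℓ' ∈ ℓ.primeFactors, θ ℓ' ^ 2 = algebraMap ℚ (ringClassField K ι ℓ) ((-1 : ℚ) ^ (ℓ' / 2) * ℓ')) →
      ∀ (hθQ : θ ℓ ∉ Set.range (algebraMap ℚ (ringClassField K ι ℓ)))
        (hθℓ : θ ℓ ^ 2 = algebraMap ℚ (ringClassField K ι ℓ) ((-1 : ℚ) ^ (ℓ / 2) * ℓ)),
      ∀ (G : Finset (ringClassField K ι ℓ ≃ₐ[ℚ] ringClassField K ι ℓ)), (∀ g, g ∈ G ↔ g ∈ ringClassGal ι ℓ) →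
      ∀ (Wn : (W.baseChange (ringClassField K ι ℓ)).toAffine.Point),
        ((2 : ℤ) ^ ℓ.primeFactors.card) • Wn =
          ∑ g ∈ G, (∏ ℓ' ∈ ℓ.primeFactors, (if g (θ ℓ') = θ ℓ' then (1 : ℤ) else -1)) •
            pointGalHom W (ringClassField K ι ℓ) g d.y →
      ∀ (m₀ : ℕ) (z₀ : (W.quadraticTwist ((-1 : ℚ) ^ (ℓ / 2) * ℓ)).toAffine.Point), Odd m₀ →
        twistPointEquivOver W hθQ hθℓ
          (QuadraticDescent.incl (ringClassField K ι ℓ : Type) (W.quadraticTwist ((-1 : ℚ) ^ (ℓ / 2) * ℓ)) z₀) =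
            (m₀ : ℤ) • Wn →
      ∀ m : ℕ, Odd m → ¬ ∃ z : (W.quadraticTwist ((-1 : ℚ) ^ (ℓ / 2) * ℓ)).toAffine.Point,
        (2 : ℤ) • z = (m : ℤ) • z₀) :
    ∃ (n : ℕ) (d : KolyvaginHeegnerData Dt β ι n) (θ : ℕ → ringClassField K ι n)
      (T : Finset (ringClassField K ι n ≃ₐ[ℚ] ringClassField K ι n)),
      Squarefree n ∧ (∀ ℓ ∈ n.primeFactors, Zhang2014.IsKolyvaginPrime (W.conductorNorm ℤ) W K 2 ℓ) ∧
      (∀ ℓ ∈ n.primeFactors, θ ℓ ^ 2 = algebraMap ℚ (ringClassField K ι n) ((-1 : ℚ) ^ (ℓ / 2) * ℓ)) ∧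
      (∀ g, g ∈ T ↔ g ∈ ringClassGal ι n ∧ ∀ ℓ ∈ n.primeFactors, g (θ ℓ) = θ ℓ) ∧
      ¬ ∃ Q : (W.baseChange (ringClassField K ι n)).toAffine.Point, (2 : ℤ) • Q =
        ∑ g ∈ T, pointGalHom W (ringClassField K ι n) g d.y := by
  refine heegner_exists_multiGenusCertificate_rowOne_of_duality_of_auxPrimitive hPT hEP hK hodd h3 hH hsurj hΔ h4 hWd h2 d₁ hM
    fun ℓ hℓ hℓ8 hKolyZ hSel1 d θ hθ G hG Wn hWn ↦ ?_
  have hKoly : ∀ ℓ' ∈ ℓ.primeFactors, Zhang2014.IsKolyvaginPrime (W.conductorNorm ℤ) W K 2 ℓ' := by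
    intro ℓ' hℓ'
    rw [Nat.Prime.primeFactors hℓ, Finset.mem_singleton] at hℓ'
    rw [hℓ']
    exact hKolyZ
  exact heegner_auxPrimitive_of_oddTwistPrimitive hK hodd hH hsurj hℓ (by omega) hKoly d hθ G hG hWd hSel1 hWn
    (fun hθQ hθℓ ↦ hprim ℓ hℓ hℓ8 hKolyZ hSel1 d θ hθ hθQ hθℓ G hG Wn hWn)

/-- **WALL ROW 1, FINAL CURRENCY: the crux's certificate from Cor. 3.4 (i) and «`z₀ ∉ 2·W^{(ℓ*)}(ℚ)`».** As
`heegner_exists_multiGenusCertificate_rowOne_of_duality_of_oddTwistPrimitive` (above; the `cor34i` form is p618536) with the odd multiples removed from the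
open hypothesis (`not_two_dvd_iff_forall_odd`): IF at every Kolyvagin prime `ℓ ≡ 7 (8)` at `2` whose even genus twist `Wd^{(−ℓ)}`
has all elliptic models Sel₂-trivial, for all data / radicals / enumerations / reduced genus points `W_ℓ`, every rational point `z₀`
of the odd twist `W^{(ℓ*)}` with `Φ(ι z₀)` an odd multiple of `W_ℓ` is NOT twice a rational point of `W^{(ℓ*)}`, THEN the
certificate clause of `MultiGenusPrimitivityAtTwo` / `stub_positiveDepth` holds on row 1. CONDITIONAL on `hPT`, `hEP` (print; NOT `cor34i_singleton_rat`) and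
`hprim` (open). [cite: MazurRubin2010, Cor. 3.4 (i)] [cite: GrossLMS1991, §3 (3.1)–(3.5), §4 (4.1), Lemma 4.3, §5]
[cite: McCallumLMS1991, §5] [cite: WZhang2014, Thm. 1.1 (the p ≥ 5 prototype)] -/
theorem heegner_exists_multiGenusCertificate_rowOne_of_duality_of_oddTwistNotTwoDvd [W.IsElliptic] [W.IsGloballyMinimal]
    (hPT : poitouTate_selmerStructure_duality_real ℚ)
    (hEP : ∀ v : IsDedekindDomain.HeightOneSpectrum (𝓞 ℚ), localEulerPoincareCharacteristic (v.adicCompletion ℚ))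
    (hK : IsImaginaryQuadratic K) (hodd : Odd (NumberField.discr K)) (h3 : NumberField.discr K ≠ -3)
    (hH : SatisfiesHeegnerHypothesis (W.conductorNorm ℤ) K) (hsurj : W.HasSurjectiveModNGaloisRep ((2 : ℤ) ^ 1))
    (hΔ : W.Δ < 0) (h4 : Nat.card (W.selmerGroup 2) = 4)
    {Wd : WeierstrassCurve ℚ} [Wd.IsElliptic] [Wd.IsGloballyMinimal] {C : VariableChange ℚ}
    (hWd : C • W.quadraticTwist (NumberField.discr K : ℚ) = Wd) (h2 : Nat.card (Wd.selmerGroup 2) = 2)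
    (d₁ : KolyvaginHeegnerData Dt β ι 1)
    (hM : ∃ Q₁ : (W.baseChange (ringClassField K ι 1)).toAffine.Point, (2 : ℤ) • Q₁ = d₁.derivedPoint)
    (hprim : ∀ ℓ : ℕ, ℓ.Prime → ℓ % 8 = 7 → Zhang2014.IsKolyvaginPrime (W.conductorNorm ℤ) W K 2 ℓ →
      (∀ (W₂ : WeierstrassCurve ℚ) [W₂.IsElliptic],
        (∃ C₂ : VariableChange ℚ, C₂ • Wd.quadraticTwist (-(ℓ : ℚ)) = W₂) → Nat.card (W₂.selmerGroup 2) = 1) →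
      ∀ (d : KolyvaginHeegnerData Dt β ι ℓ) (θ : ℕ → ringClassField K ι ℓ),
        (∀ ℓ' ∈ ℓ.primeFactors, θ ℓ' ^ 2 = algebraMap ℚ (ringClassField K ι ℓ) ((-1 : ℚ) ^ (ℓ' / 2) * ℓ')) →
      ∀ (hθQ : θ ℓ ∉ Set.range (algebraMap ℚ (ringClassField K ι ℓ)))
        (hθℓ : θ ℓ ^ 2 = algebraMap ℚ (ringClassField K ι ℓ) ((-1 : ℚ) ^ (ℓ / 2) * ℓ)),
      ∀ (G : Finset (ringClassField K ι ℓ ≃ₐ[ℚ] ringClassField K ι ℓ)), (∀ g, g ∈ G ↔ g ∈ ringClassGal ι ℓ) →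
      ∀ (Wn : (W.baseChange (ringClassField K ι ℓ)).toAffine.Point),
        ((2 : ℤ) ^ ℓ.primeFactors.card) • Wn =
          ∑ g ∈ G, (∏ ℓ' ∈ ℓ.primeFactors, (if g (θ ℓ') = θ ℓ' then (1 : ℤ) else -1)) •
            pointGalHom W (ringClassField K ι ℓ) g d.y →
      ∀ (m₀ : ℕ) (z₀ : (W.quadraticTwist ((-1 : ℚ) ^ (ℓ / 2) * ℓ)).toAffine.Point), Odd m₀ →
        twistPointEquivOver W hθQ hθℓ
          (QuadraticDescent.incl (ringClassField K ι ℓ : Type) (W.quadraticTwist ((-1 : ℚ) ^ (ℓ / 2) * ℓ)) z₀) =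
            (m₀ : ℤ) • Wn →
      ¬ ∃ z : (W.quadraticTwist ((-1 : ℚ) ^ (ℓ / 2) * ℓ)).toAffine.Point, (2 : ℤ) • z = z₀) :
    ∃ (n : ℕ) (d : KolyvaginHeegnerData Dt β ι n) (θ : ℕ → ringClassField K ι n)
      (T : Finset (ringClassField K ι n ≃ₐ[ℚ] ringClassField K ι n)),
      Squarefree n ∧ (∀ ℓ ∈ n.primeFactors, Zhang2014.IsKolyvaginPrime (W.conductorNorm ℤ) W K 2 ℓ) ∧
      (∀ ℓ ∈ n.primeFactors, θ ℓ ^ 2 = algebraMap ℚ (ringClassField K ι n) ((-1 : ℚ) ^ (ℓ / 2) * ℓ)) ∧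
      (∀ g, g ∈ T ↔ g ∈ ringClassGal ι n ∧ ∀ ℓ ∈ n.primeFactors, g (θ ℓ) = θ ℓ) ∧
      ¬ ∃ Q : (W.baseChange (ringClassField K ι n)).toAffine.Point, (2 : ℤ) • Q =
        ∑ g ∈ T, pointGalHom W (ringClassField K ι n) g d.y :=
  heegner_exists_multiGenusCertificate_rowOne_of_duality_of_oddTwistPrimitive hPT hEP hK hodd h3 hH hsurj hΔ h4 hWd h2 d₁ hM
    fun ℓ hℓ hℓ8 hKolyZ hSel1 d θ hθ hθQ hθℓ G hG Wn hWn m₀ z₀ hm₀ hz₀ ↦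
      (not_two_dvd_iff_forall_odd z₀).mpr (hprim ℓ hℓ hℓ8 hKolyZ hSel1 d θ hθ hθQ hθℓ G hG Wn hWn m₀ z₀ hm₀ hz₀)

end Heegner

end Summit.BirchSwinnertonDyer.BirchSwinnertonDyer.Theorems.GenusKoly

end
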